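import Summits.HodgeConjecture.HodgeConjecture.Theorems.K2E3CongruenceLayerCharactersGL   -- ★ p855532 (this seat): (H-char) `χ_X(k) = ψ(tr(X(k−1)))`, equivariance, non-degeneracy; brings ★ p855410 (H1) layers, ★ `GLnCongruenceCommutators`, ★ `CongruenceSubgroupExpansionGL`, ★ `GLnCongruenceSubgroups`
import HarnessLib

/-!
# Crux `H413` — K2-LIT E3 «EllipticInputs», U12-h engine (H3-lite): INTERTWINING OF CONGRUENCE-LAYER CHARACTERS FORCES NEAR-COMMUTATION OF THE PARAMETER —
# an element `x` of height `h` conjugates `K_{m+2h}` into `K_m`, `χ_X(x k x⁻¹) = χ_{x⁻¹Xx}(k)`, and if `x` intertwines `χ_X` with `χ_{X'}` on `K_{m+2h}` then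
# `v(x⁻¹Xx − X') ≤ |ϖ|^{−(m+2h)}` (and conversely)

Cell `hodgecm-mathlib`, Track B «K2-LIT», crux item `stmt-HodgeConjecture-24833` (h413), line `K2_E3_EllipticInputs`, unit U12 «HC characters», socket U12-h
`sig_K2E3CharLocConstNearRegular` (‹#9L›): Howe road brick (H3) «INTERTWINING CRITERION» (HC1999 Cor. 17.2: `x` intertwines `d₂` with `d₁` iff `𝒪_{d₁} ∩ Ad(x)𝒪_{d₂} ≠ ∅`)
in its LITE form for the ABELIAN layers `K_m ⧸ K_{2m}` of `GL_n(F)` — precision `ϖ^{−(m+2h)}` instead of Howe's exact orbits (no `K^{1/2}` refinement); this is the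
input shape «`Ad(γt)X₀ − Ad(k)X₀ ∈ L^⊥`» of HC1999 Lemma 19.4 (K2E3-p09 memo v3 §3 (F1), `x = γt` of bounded height on the torus slice).  Cut proposed on the K2 bus
2026-09-03T23:03:54Z by seat K2E1b-p08 (g2) to the 9L line lead K2E3-p09 (g2) under K2E3-plan (g1)'s BATCH #3 free-hand rule; `--supports stmt-HodgeConjecture-24833 --as helper`.
THEOREMS ONLY — no `def` (characters inline as `ψ (Matrix.trace (X * (↑k − 1)))`), no named fact, no instance, no notation, no `sorry`.  GENERIC: any field with a
`ValuativeRel` and a uniformizer `ϖ` (★ `IsUniformizingElement`), any `ψ : AddChar F M` with explicit conductor hypotheses.  HONEST LABEL: HC_CM is proved only modulo the 7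
printed citations (2 remaining named inputs: hLiu418 = stmt-HodgeConjecture-24832, h413 = stmt-HodgeConjecture-24833) until rung 0 closes; count-neutral generic algebra.

THE MATHEMATICS [HarishChandra1999, §17 Cor. 17.2 and §19 Lemma 19.4; Howe1977Kirillov, §1; BushnellHenniart2006, §1.7].  HEIGHT: `x ∈ GL_n(F)` has height `≤ h` if the
entries of `x` and of `x⁻¹` have `v ≤ |ϖ|^{−h}`.  Then:
* §1 (A) **`x K_{m+2h} x⁻¹ ⊆ K_m`** (`xkx⁻¹ − 1 = x(k−1)x⁻¹`, ★ `coe_conj_sub_one`; general form with three valuation bounds `η·δ·η' ≤ γ ≤ 1`), hence `K_{m+2h} ⊆ K_m ∩ x⁻¹K_mx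
  ∩ xK_mx⁻¹` — the OVERLAP on which intertwining is tested contains a deep level;
* §2 (B) = ★ (H-char) `map_trace_mul_coe_conj_sub_one` read for an arbitrary `x`: `χ_X(xkx⁻¹) = χ_{x⁻¹Xx}(k)` — conjugating the argument is the CO-ADJOINT action on the
  parameter; (C) **if `χ_X(xkx⁻¹) = χ_{X'}(k)` for all `k ∈ K_{m+2h}` («`x` intertwines `χ_X` with `χ_{X'}` on the overlap») then `v(x⁻¹Xx − X') ≤ |ϖ|^{−(m+2h)}`**, i.e.
  `Ad*(x)X` and `X'` AGREE modulo `ϖ^{−(m+2h)}M_n(𝒪)` (★ (H-char) §3 non-degeneracy `forall_map_trace_eq_iff_valBound_sub` at level `m + 2h`, `ψ` of conductor exactly `𝒪`,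
  values in a commutative GROUP), and (C′) the converse; (D) the representation-theoretic reading: agreement of `k ↦ χ_X(x⁻¹kx)` and `χ_{X'}` on
  `{k ∈ K_m : x⁻¹kx ∈ K_m}` (non-zero `Hom` between the one-dimensional types on `K_m ∩ xK_mx⁻¹`) ⇒ `v(xXx⁻¹ − X') ≤ |ϖ|^{−(m+2h)}`; self-intertwining (`X' = X`):
  **`v(xXx⁻¹ − X) ≤ |ϖ|^{−(m+2h)}`** — `x` ALMOST COMMUTES with `X`.
What is NOT here: Howe's exact orbit statement (intersection of the `Ad(K)`-orbits `X + L^⊥` themselves, HC Thm. 17.1 ∕ Cor. 17.2 with `K^{1/2}`), which needs (H2) proper.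

## References
* [HarishChandra1999] Harish-Chandra (DeBacker–Sally), *Admissible Invariant Distributions on Reductive p-adic Groups*, ULECT 16 (1999), §17 (Thm. 17.1, Cor. 17.2), §19 (Lemma 19.4).
* [Howe1977Kirillov] R. Howe, *Kirillov theory for compact p-adic groups*, Pacific J. Math. 73 (1977), 365–381, §1.
* [BushnellHenniart2006] C. J. Bushnell, G. Henniart, *The Local Langlands Conjecture for GL(2)*, Grundlehren 335 (2006), §1.7, §1.1.
-/

set_option autoImplicit false
-- the mandated namespace repeats `HodgeConjecture.HodgeConjecture`, as in every `Theorems/*.lean` of this sub-problem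
set_option linter.dupNamespace false

noncomputable section

open scoped MatrixGroups
open Matrix ValuativeRel Literature.NumberTheory.Automorphic

namespace Summit.HodgeConjecture.HodgeConjecture.Cruxes.H413.K2E3CongruenceLayerIntertwiningGL

variable {F : Type*} [Field F] [ValuativeRel F] {n : ℕ}

/-! ## §1 (A) Conjugating a deep level by an element of bounded height -/

section Height

/-- **(A, general levels) `x K_δ x⁻¹ ⊆ K_γ` when `v(x) ≤ η`, `v(x⁻¹) ≤ η'`, `ηδη' ≤ γ ≤ 1`**: `xkx⁻¹ − 1 = x(k−1)x⁻¹` (★ `coe_conj_sub_one`) has entries `≤ ηδη'`, likewise for the inverse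
`xk⁻¹x⁻¹`, and integrality follows from `γ ≤ 1` (★ `ValBound.of_sub_one`). [cite: HarishChandra1999, §17 p. 80] [cite: BushnellHenniart2006, §1.1] -/
theorem conj_mem_congruenceGL_of_valBound {η η' δ γ : ValueGroupWithZero F} (hle : η * δ * η' ≤ γ) (hγ : γ ≤ 1) {x k : GL (Fin n) F}
    (hx : ValBound η (x : Matrix (Fin n) (Fin n) F)) (hx' : ValBound η' ((x⁻¹ : GL (Fin n) F) : Matrix (Fin n) (Fin n) F)) (hk : k ∈ congruenceGL n δ) :
    x * k * x⁻¹ ∈ congruenceGL n γ := by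
  have h1 : ValBound γ (((x * k * x⁻¹ : GL (Fin n) F) : Matrix (Fin n) (Fin n) F) - 1) := by
    rw [K2E3CongruenceLayersGL.coe_conj_sub_one]
    exact ((hx.mul hk.2.1).mul hx').mono hle
  have h2 : ValBound γ ((((x * k * x⁻¹)⁻¹ : GL (Fin n) F) : Matrix (Fin n) (Fin n) F) - 1) := by
    rw [show (x * k * x⁻¹)⁻¹ = x * k⁻¹ * x⁻¹ by group, K2E3CongruenceLayersGL.coe_conj_sub_one]
    exact ((hx.mul hk.2.2).mul hx').mono hle
  exact ⟨⟨h1.of_sub_one hγ, h2.of_sub_one hγ⟩, h1, h2⟩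

variable {ϖ : F}

/-- The level arithmetic of (A): `|ϖ|^{−h} · |ϖ|^{m+2h} · |ϖ|^{−h} = |ϖ|^m`. [folklore] -/
theorem inv_pow_mul_pow_add_two_mul_mul_inv_pow (hϖ : IsUniformizingElement ϖ) (m h : ℕ) :
    (valuation F ϖ ^ h)⁻¹ * valuation F ϖ ^ (m + 2 * h) * (valuation F ϖ ^ h)⁻¹ = valuation F ϖ ^ m := by
  have hu : valuation F ϖ ^ h ≠ 0 := pow_ne_zero _ ((Valuation.ne_zero_iff _).2 hϖ.ne_zero)
  rw [two_mul, ← add_assoc, pow_add, pow_add, ← mul_assoc (valuation F ϖ ^ h)⁻¹ (valuation F ϖ ^ m * valuation F ϖ ^ h) (valuation F ϖ ^ h),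
    mul_inv_cancel_right₀ hu, ← mul_assoc, mul_comm (valuation F ϖ ^ h)⁻¹ (valuation F ϖ ^ m), inv_mul_cancel_right₀ hu]

/-- **(A) AN ELEMENT OF HEIGHT `≤ h` CONJUGATES `K_{m+2h}` INTO `K_m`**: `v(x) ≤ |ϖ|^{−h}`, `v(x⁻¹) ≤ |ϖ|^{−h}`, `k ∈ K_{m+2h}` ⇒ `xkx⁻¹ ∈ K_m`.
[cite: HarishChandra1999, §17 p. 80 and §19 Lemma 19.4] [cite: Howe1977Kirillov, §1] -/
theorem conj_mem_congruenceGL_pow_of_height (hϖ : IsUniformizingElement ϖ) (m h : ℕ) {x k : GL (Fin n) F}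
    (hx : ValBound (valuation F ϖ ^ h)⁻¹ (x : Matrix (Fin n) (Fin n) F)) (hx' : ValBound (valuation F ϖ ^ h)⁻¹ ((x⁻¹ : GL (Fin n) F) : Matrix (Fin n) (Fin n) F))
    (hk : k ∈ congruenceGL n (valuation F ϖ ^ (m + 2 * h))) : x * k * x⁻¹ ∈ congruenceGL n (valuation F ϖ ^ m) :=
  conj_mem_congruenceGL_of_valBound (le_of_eq (inv_pow_mul_pow_add_two_mul_mul_inv_pow hϖ m h)) (pow_le_one₀ zero_le hϖ.valuation_le_one) hx hx' hk

/-- … and `x⁻¹ k x ∈ K_m` as well (apply (A) to `x⁻¹`, of the same height). [cite: HarishChandra1999, §17 p. 80] -/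
theorem inv_conj_mem_congruenceGL_pow_of_height (hϖ : IsUniformizingElement ϖ) (m h : ℕ) {x k : GL (Fin n) F}
    (hx : ValBound (valuation F ϖ ^ h)⁻¹ (x : Matrix (Fin n) (Fin n) F)) (hx' : ValBound (valuation F ϖ ^ h)⁻¹ ((x⁻¹ : GL (Fin n) F) : Matrix (Fin n) (Fin n) F))
    (hk : k ∈ congruenceGL n (valuation F ϖ ^ (m + 2 * h))) : x⁻¹ * k * x ∈ congruenceGL n (valuation F ϖ ^ m) := by
  have h := conj_mem_congruenceGL_pow_of_height hϖ m h (x := x⁻¹) hx' (by rwa [inv_inv]) hk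
  rwa [inv_inv] at h

/-- The deep level lies in the shallow one: `K_{m+2h} ≤ K_m`. [folklore] -/
theorem congruenceGL_pow_add_le (hϖ : IsUniformizingElement ϖ) (m e : ℕ) :
    congruenceGL n (valuation F ϖ ^ (m + e)) ≤ congruenceGL n (valuation F ϖ ^ m) :=
  congruenceGL_mono (by rw [pow_add]; exact mul_le_of_le_one_right' (pow_le_one₀ zero_le hϖ.valuation_le_one))

/-- **THE OVERLAP CONTAINS A DEEP LEVEL**: for `x` of height `≤ h`, every `k ∈ K_{m+2h}` lies in `K_m`, with `xkx⁻¹ ∈ K_m` and `x⁻¹kx ∈ K_m` — so `K_{m+2h} ⊆ K_m ∩ xK_mx⁻¹ ∩ x⁻¹K_mx`,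
the subgroup on which «`x` intertwines `d₁` with `d₂`» is tested. [cite: HarishChandra1999, §17 Cor. 17.2] -/
theorem mem_overlap_of_mem_congruenceGL_pow_add (hϖ : IsUniformizingElement ϖ) (m h : ℕ) {x k : GL (Fin n) F}
    (hx : ValBound (valuation F ϖ ^ h)⁻¹ (x : Matrix (Fin n) (Fin n) F)) (hx' : ValBound (valuation F ϖ ^ h)⁻¹ ((x⁻¹ : GL (Fin n) F) : Matrix (Fin n) (Fin n) F))
    (hk : k ∈ congruenceGL n (valuation F ϖ ^ (m + 2 * h))) :
    k ∈ congruenceGL n (valuation F ϖ ^ m) ∧ x * k * x⁻¹ ∈ congruenceGL n (valuation F ϖ ^ m) ∧ x⁻¹ * k * x ∈ congruenceGL n (valuation F ϖ ^ m) :=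
  ⟨congruenceGL_pow_add_le hϖ m (2 * h) hk, conj_mem_congruenceGL_pow_of_height hϖ m h hx hx' hk, inv_conj_mem_congruenceGL_pow_of_height hϖ m h hx hx' hk⟩

end Height

/-! ## §2 (B)–(D) Intertwining on the overlap ⟺ near-commutation of the parameters -/

section Intertwining

variable {M : Type*} [CommGroup M] (ψ : AddChar F M) {ϖ : F}

/-- **(C) INTERTWINING ON `K_N` ⇒ THE PARAMETERS AGREE MODULO `ϖ^{−N}M_n(𝒪)`** (`ψ` of conductor exactly `𝒪`, `N ≥ 1`, ANY `x ∈ GL_n(F)`): if `χ_X(xkx⁻¹) = χ_{X'}(k)` for all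
`k ∈ K_N` then `v(x⁻¹Xx − X') ≤ |ϖ|^{−N}` — by (B) ★ `map_trace_mul_coe_conj_sub_one` (`χ_X(xkx⁻¹) = χ_{x⁻¹Xx}(k)`) and ★ non-degeneracy `forall_map_trace_eq_iff_valBound_sub`.
Use with `N = m + 2h` for `x` of height `≤ h` (§1: then `xK_Nx⁻¹ ⊆ K_m`, where `χ_X` is a character). [cite: HarishChandra1999, §17 Cor. 17.2] [cite: Howe1977Kirillov, §1] -/
theorem valBound_conj_sub_of_forall_map_trace_conj_eq (hϖ : IsUniformizingElement ϖ) (hψ : ∀ y : F, valuation F y ≤ 1 → ψ y = 1)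
    (hψ' : ∃ y : F, valuation F y ≤ (valuation F ϖ)⁻¹ ∧ ψ y ≠ 1) {N : ℕ} (hN : 1 ≤ N) {X X' : Matrix (Fin n) (Fin n) F} {x : GL (Fin n) F}
    (hint : ∀ k ∈ congruenceGL n (valuation F ϖ ^ N),
      ψ (Matrix.trace (X * (((x * k * x⁻¹ : GL (Fin n) F) : Matrix (Fin n) (Fin n) F) - 1))) = ψ (Matrix.trace (X' * ((k : Matrix (Fin n) (Fin n) F) - 1)))) :
    ValBound (valuation F ϖ ^ N)⁻¹ (((x⁻¹ : GL (Fin n) F) : Matrix (Fin n) (Fin n) F) * X * (x : Matrix (Fin n) (Fin n) F) - X') := by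
  refine (K2E3CongruenceLayerCharactersGL.forall_map_trace_eq_iff_valBound_sub ψ hϖ hψ hψ' hN X' _).1 fun k hk => ?_
  rw [← K2E3CongruenceLayerCharactersGL.map_trace_mul_coe_conj_sub_one ψ X x k]
  exact hint k hk

/-- **(C′) THE CONVERSE**: if `v(x⁻¹Xx − X') ≤ |ϖ|^{−N}` then `χ_X(xkx⁻¹) = χ_{X'}(k)` for all `k ∈ K_N` (`ψ` trivial on `𝒪`; no height hypothesis).
[cite: HarishChandra1999, §17 Cor. 17.2] [cite: Howe1977Kirillov, §1] -/
theorem forall_map_trace_conj_eq_of_valBound_conj_sub (hϖ : IsUniformizingElement ϖ) (hψ : ∀ y : F, valuation F y ≤ 1 → ψ y = 1)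
    (hψ' : ∃ y : F, valuation F y ≤ (valuation F ϖ)⁻¹ ∧ ψ y ≠ 1) {N : ℕ} (hN : 1 ≤ N) {X X' : Matrix (Fin n) (Fin n) F} {x : GL (Fin n) F}
    (hXX' : ValBound (valuation F ϖ ^ N)⁻¹ (((x⁻¹ : GL (Fin n) F) : Matrix (Fin n) (Fin n) F) * X * (x : Matrix (Fin n) (Fin n) F) - X')) :
    ∀ k ∈ congruenceGL n (valuation F ϖ ^ N),
      ψ (Matrix.trace (X * (((x * k * x⁻¹ : GL (Fin n) F) : Matrix (Fin n) (Fin n) F) - 1))) = ψ (Matrix.trace (X' * ((k : Matrix (Fin n) (Fin n) F) - 1))) := by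
  intro k hk
  rw [K2E3CongruenceLayerCharactersGL.map_trace_mul_coe_conj_sub_one ψ X x k]
  exact (K2E3CongruenceLayerCharactersGL.forall_map_trace_eq_iff_valBound_sub ψ hϖ hψ hψ' hN X' _).2 hXX' k hk

/-- **(C⟺C′) packaged**: intertwining of `χ_X` (conjugated by `x`) with `χ_{X'}` on `K_N` ⟺ `v(x⁻¹Xx − X') ≤ |ϖ|^{−N}`. [cite: HarishChandra1999, §17 Cor. 17.2] -/
theorem forall_map_trace_conj_eq_iff_valBound_conj_sub (hϖ : IsUniformizingElement ϖ) (hψ : ∀ y : F, valuation F y ≤ 1 → ψ y = 1)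
    (hψ' : ∃ y : F, valuation F y ≤ (valuation F ϖ)⁻¹ ∧ ψ y ≠ 1) {N : ℕ} (hN : 1 ≤ N) (X X' : Matrix (Fin n) (Fin n) F) (x : GL (Fin n) F) :
    (∀ k ∈ congruenceGL n (valuation F ϖ ^ N),
        ψ (Matrix.trace (X * (((x * k * x⁻¹ : GL (Fin n) F) : Matrix (Fin n) (Fin n) F) - 1))) = ψ (Matrix.trace (X' * ((k : Matrix (Fin n) (Fin n) F) - 1)))) ↔
      ValBound (valuation F ϖ ^ N)⁻¹ (((x⁻¹ : GL (Fin n) F) : Matrix (Fin n) (Fin n) F) * X * (x : Matrix (Fin n) (Fin n) F) - X') :=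
  ⟨valBound_conj_sub_of_forall_map_trace_conj_eq ψ hϖ hψ hψ' hN, forall_map_trace_conj_eq_of_valBound_conj_sub ψ hϖ hψ hψ' hN⟩

/-- **(D) THE REPRESENTATION-THEORETIC READING.**  `x` of height `≤ h`; the one-dimensional types `χ_X`, `χ_{X'}` of `K_m` (parameters `X, X'`, `ψ` of conductor exactly `𝒪`).  If the
pulled-back character `k ↦ χ_X(x⁻¹kx)` agrees with `χ_{X'}` on the overlap `{k ∈ K_m : x⁻¹kx ∈ K_m}` (a non-zero `Hom` between the types `d₁^x` and `d₂` on `K_m ∩ xK_mx⁻¹`, HC's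
«`x` intertwines `d₁` with `d₂`»), then — testing only on `K_{m+2h} ⊆` overlap (§1) — **`v(xXx⁻¹ − X') ≤ |ϖ|^{−(m+2h)}`**: the co-adjoint orbits `Ad(x)X` and `X'` meet to precision
`ϖ^{−(m+2h)}`. [cite: HarishChandra1999, §17 Cor. 17.2 and §19 Lemma 19.4] [cite: Howe1977Kirillov, §1] -/
theorem valBound_conj_sub_of_intertwines_on_overlap (hϖ : IsUniformizingElement ϖ) (hψ : ∀ y : F, valuation F y ≤ 1 → ψ y = 1)
    (hψ' : ∃ y : F, valuation F y ≤ (valuation F ϖ)⁻¹ ∧ ψ y ≠ 1) (m h : ℕ) (hm : 1 ≤ m + 2 * h) {X X' : Matrix (Fin n) (Fin n) F} {x : GL (Fin n) F}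
    (hx : ValBound (valuation F ϖ ^ h)⁻¹ (x : Matrix (Fin n) (Fin n) F)) (hx' : ValBound (valuation F ϖ ^ h)⁻¹ ((x⁻¹ : GL (Fin n) F) : Matrix (Fin n) (Fin n) F))
    (hover : ∀ k ∈ congruenceGL n (valuation F ϖ ^ m), x⁻¹ * k * x ∈ congruenceGL n (valuation F ϖ ^ m) →
      ψ (Matrix.trace (X * (((x⁻¹ * k * x : GL (Fin n) F) : Matrix (Fin n) (Fin n) F) - 1))) = ψ (Matrix.trace (X' * ((k : Matrix (Fin n) (Fin n) F) - 1)))) :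
    ValBound (valuation F ϖ ^ (m + 2 * h))⁻¹ ((x : Matrix (Fin n) (Fin n) F) * X * ((x⁻¹ : GL (Fin n) F) : Matrix (Fin n) (Fin n) F) - X') := by
  have h := valBound_conj_sub_of_forall_map_trace_conj_eq ψ hϖ hψ hψ' hm (X := X) (X' := X') (x := x⁻¹) fun k hk => by
    have ho := mem_overlap_of_mem_congruenceGL_pow_add hϖ m h hx hx' hk
    rw [inv_inv]
    exact hover k ho.1 ho.2.2
  rwa [inv_inv] at h

/-- **(D, self-intertwining) `x` INTERTWINES `χ_X` WITH ITSELF ⇒ `x` ALMOST COMMUTES WITH `X`: `v(xXx⁻¹ − X) ≤ |ϖ|^{−(m+2h)}`** — the input shape of HC1999 Lemma 19.4 («`Ad(γt)X₀ − Ad(k)X₀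
∈ L^⊥`») at `x = γt` of bounded height on the torus slice. [cite: HarishChandra1999, §19 Lemma 19.4] [cite: Howe1977Kirillov, §1] -/
theorem valBound_conj_sub_self_of_intertwines_on_overlap (hϖ : IsUniformizingElement ϖ) (hψ : ∀ y : F, valuation F y ≤ 1 → ψ y = 1)
    (hψ' : ∃ y : F, valuation F y ≤ (valuation F ϖ)⁻¹ ∧ ψ y ≠ 1) (m h : ℕ) (hm : 1 ≤ m + 2 * h) {X : Matrix (Fin n) (Fin n) F} {x : GL (Fin n) F}
    (hx : ValBound (valuation F ϖ ^ h)⁻¹ (x : Matrix (Fin n) (Fin n) F)) (hx' : ValBound (valuation F ϖ ^ h)⁻¹ ((x⁻¹ : GL (Fin n) F) : Matrix (Fin n) (Fin n) F))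
    (hover : ∀ k ∈ congruenceGL n (valuation F ϖ ^ m), x⁻¹ * k * x ∈ congruenceGL n (valuation F ϖ ^ m) →
      ψ (Matrix.trace (X * (((x⁻¹ * k * x : GL (Fin n) F) : Matrix (Fin n) (Fin n) F) - 1))) = ψ (Matrix.trace (X * ((k : Matrix (Fin n) (Fin n) F) - 1)))) :
    ValBound (valuation F ϖ ^ (m + 2 * h))⁻¹ ((x : Matrix (Fin n) (Fin n) F) * X * ((x⁻¹ : GL (Fin n) F) : Matrix (Fin n) (Fin n) F) - X) :=
  valBound_conj_sub_of_intertwines_on_overlap ψ hϖ hψ hψ' m h hm hx hx' hover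

/-- The commutator form of near-commutation: `v(xXx⁻¹ − X) ≤ ρ` iff `v(xX − Xx) ≤ ?` is NOT equivalent in general, but one direction is cheap and is what norm estimates use:
**`xX − Xx = (xXx⁻¹ − X)·x`**, so `v(xX − Xx) ≤ ρ·v(x)` entrywise (here: `≤ |ϖ|^{−(m+2h)}·|ϖ|^{−h}`). [cite: HarishChandra1999, §19 Lemma 19.4] -/
theorem valBound_mul_sub_mul_of_valBound_conj_sub {ρ η : ValueGroupWithZero F} {X : Matrix (Fin n) (Fin n) F} {x : GL (Fin n) F}
    (hx : ValBound η (x : Matrix (Fin n) (Fin n) F)) (h : ValBound ρ ((x : Matrix (Fin n) (Fin n) F) * X * ((x⁻¹ : GL (Fin n) F) : Matrix (Fin n) (Fin n) F) - X)) :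
    ValBound (ρ * η) ((x : Matrix (Fin n) (Fin n) F) * X - X * (x : Matrix (Fin n) (Fin n) F)) := by
  have e : (x : Matrix (Fin n) (Fin n) F) * X - X * (x : Matrix (Fin n) (Fin n) F) =
      ((x : Matrix (Fin n) (Fin n) F) * X * ((x⁻¹ : GL (Fin n) F) : Matrix (Fin n) (Fin n) F) - X) * (x : Matrix (Fin n) (Fin n) F) := by
    rw [Matrix.sub_mul, Matrix.mul_assoc, ← Units.val_mul, inv_mul_cancel, Units.val_one, Matrix.mul_one]
  rw [e]
  exact h.mul hx

end Intertwining

end Summit.HodgeConjecture.HodgeConjecture.Cruxes.H413.K2E3CongruenceLayerIntertwiningGL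

end
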